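import Summits.AtomisticToContinuum.Crystallization.Theses.NashClassCertificates
import Summits.AtomisticToContinuum.Crystallization.Theorems.PhononSlackCertificatesCoerciveTwoShellGapBlocks
import Summits.AtomisticToContinuum.Crystallization.Theorems.NashClassCertificatesNashTwoShellGapReductions

/-!
# Crux `NashTwoShellGap` (stmt-AtomisticToContinuum-16826), line `birth`, stub `stub_exposedBadGap`:
# the exposed-bad gap on the Nash class FOLLOWS FROM every form of the two-shell gap in the tree

The registered stub `stub_exposedBadGap` of line `birth` asks for `g > 0` with

  `N·e* + g·#{i : ¬ IsTwoShellGood (1/20) (47/50) 1 x i ∧ ∃ p, |p − x_i| ≤ 6/5 ∧ ∀ j, |p − x_j| ≥ 9/10} ≤ 𝓔_LJ(x)`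

for every `1/2`-separated finite configuration `x` of `ℝ³` that is NASH for `V_LJ`
(`siteEnergy x i ≤ ∑_{j ≠ i} V_LJ(|y − x_j|)` for every `i` and every free `y`), where
`e* = ⨅_Q e(Q)` over periodic `Q`.  It is the EXPOSED half of the crux's bad count (a `9/10`-hole
within `6/5` of the bad particle: outer surface, steps, kinks, void walls).

This helper file does NOT close the stub.  It records, kernel-checked, that the stub is a
CONSEQUENCE (smaller count, smaller configuration class) of each of the following, so that a proof
of any of them discharges it by one `exact`:

* `exposedBadGap_of_halfSepTwoShellGap` — the finite two-shell gap at separation `1/2`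
  (no Nash hypothesis): the `δ := 1/2` instance of `CoerciveTwoShellGap` (stmt-13956);
* `exposedBadGap_of_nashHalfSepTwoShellGap` — the same on the Nash class only (the common parent
  of the two gap stubs of line `birth`);
* `exposedBadGap_of_nashTwoShellGap` — the crux `NashClassCertificates.NashTwoShellGap` itself
  (`1/2`-separated ⇒ `1/3`-separated);
* `exposedBadGap_of_sepTwoShellGap` — the finite two-shell gap at separation `1/3`;
* `exposedBadGap_of_coerciveTwoShellGap` — `PhononSlackCertificates.CoerciveTwoShellGap`
  (stmt-13956), instantiated at `δ := 1/2`;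
* `exposedBadGap_of_torusTwoShellGap` — the TWO-SHELL GAP ON THE TORUS, via the tree theorem
  `CoerciveTwoShellGapBlocks.coerciveTwoShellGap_iff_torusTwoShellGap`.

The only ingredient beyond bookkeeping is the count monotonicity `#{bad ∧ exposed} ≤ #{bad}`
(the landed `NashTwoShellGapReductions.natCard_bad_and_le`, a subtype injection on `Fin N`); this
file is the exposed-side companion of the lead's `NashClassCertificatesNashTwoShellGapReductions`
(jammed side).
-/

noncomputable section

namespace Summit.AtomisticToContinuum.Crystallization.Theorems.NashTwoShellGapExposedBadGap

open scoped BigOperators Classical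
open Literature.MathematicalPhysics.StatisticalMechanics Literature.Geometry.DiscreteGeometry
open Summit.AtomisticToContinuum.Crystallization.Theorems.NashTwoShellGapReductions (natCard_bad_and_le)

/-! ## Counting: the exposed-bad count is a sub-count of the bad count -/

/-- **Pointwise monotonicity of the gap in the charged set.**  For one configuration `x` and one
`g ≥ 0`: if `N·e* + g·#{bad} ≤ 𝓔(x)` then `N·e* + g·#{bad ∧ exposed} ≤ 𝓔(x)`. [folklore] -/
theorem gap_exposed_of_gap_bad {N : ℕ} (x : Fin N → EuclideanSpace ℝ (Fin 3)) {g : ℝ} (hg : 0 ≤ g)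
    (h : (N : ℝ) * (⨅ Q : PeriodicConfiguration 3, Q.energyPerParticle lennardJones) +
        g * (Nat.card {i : Fin N // ¬ IsTwoShellGood (1 / 20) (47 / 50) 1 x i} : ℝ) ≤
      interactionEnergy lennardJones x) :
    (N : ℝ) * (⨅ Q : PeriodicConfiguration 3, Q.energyPerParticle lennardJones) +
        g * (Nat.card {i : Fin N // ¬ IsTwoShellGood (1 / 20) (47 / 50) 1 x i ∧
          ∃ p : EuclideanSpace ℝ (Fin 3), dist p (x i) ≤ 6 / 5 ∧ ∀ j : Fin N, 9 / 10 ≤ dist p (x j)} : ℝ) ≤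
      interactionEnergy lennardJones x := by
  have hle : (Nat.card {i : Fin N // ¬ IsTwoShellGood (1 / 20) (47 / 50) 1 x i ∧
          ∃ p : EuclideanSpace ℝ (Fin 3), dist p (x i) ≤ 6 / 5 ∧ ∀ j : Fin N, 9 / 10 ≤ dist p (x j)} : ℝ) ≤
      (Nat.card {i : Fin N // ¬ IsTwoShellGood (1 / 20) (47 / 50) 1 x i} : ℝ) := by
    exact_mod_cast natCard_bad_and_le _ _
  have hmul := mul_le_mul_of_nonneg_left hle hg
  linarith

/-! ## The stub from the finite two-shell gap at separation `1/2` (with or without Nash) -/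

/-- **Exposed-bad gap on the Nash class ⇐ the `1/2`-separated two-shell gap on the Nash class**
(the common parent of both gap stubs of line `birth`): drop nothing, shrink the charged set.
[folklore] -/
theorem exposedBadGap_of_nashHalfSepTwoShellGap
    (h : ∃ g : ℝ, 0 < g ∧ ∀ (N : ℕ) (x : Fin N → EuclideanSpace ℝ (Fin 3)),
      (∀ i j : Fin N, i ≠ j → 1 / 2 ≤ dist (x i) (x j)) →
      (∀ (i : Fin N) (y : EuclideanSpace ℝ (Fin 3)), (∀ j : Fin N, j ≠ i → y ≠ x j) →
        siteEnergy lennardJones x i ≤ ∑ j ∈ Finset.univ.erase i, lennardJones (dist y (x j))) →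
      (N : ℝ) * (⨅ Q : PeriodicConfiguration 3, Q.energyPerParticle lennardJones) +
          g * (Nat.card {i : Fin N // ¬ IsTwoShellGood (1 / 20) (47 / 50) 1 x i} : ℝ) ≤
        interactionEnergy lennardJones x) :
    ∃ g : ℝ, 0 < g ∧ ∀ (N : ℕ) (x : Fin N → EuclideanSpace ℝ (Fin 3)),
      (∀ i j : Fin N, i ≠ j → 1 / 2 ≤ dist (x i) (x j)) →
      (∀ (i : Fin N) (y : EuclideanSpace ℝ (Fin 3)), (∀ j : Fin N, j ≠ i → y ≠ x j) →
        siteEnergy lennardJones x i ≤ ∑ j ∈ Finset.univ.erase i, lennardJones (dist y (x j))) →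
      (N : ℝ) * (⨅ Q : PeriodicConfiguration 3, Q.energyPerParticle lennardJones) +
          g * (Nat.card {i : Fin N // ¬ IsTwoShellGood (1 / 20) (47 / 50) 1 x i ∧
            ∃ p : EuclideanSpace ℝ (Fin 3), dist p (x i) ≤ 6 / 5 ∧ ∀ j : Fin N, 9 / 10 ≤ dist p (x j)} : ℝ) ≤
        interactionEnergy lennardJones x := by
  obtain ⟨g, hg, hG⟩ := h
  exact ⟨g, hg, fun N x hsep hnash => gap_exposed_of_gap_bad x hg.le (hG N x hsep hnash)⟩

/-- **Exposed-bad gap on the Nash class ⇐ the finite two-shell gap at separation `1/2`** (all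
`1/2`-separated configurations, no Nash hypothesis: the `δ := 1/2` instance of
`CoerciveTwoShellGap`, stmt-13956). [folklore] -/
theorem exposedBadGap_of_halfSepTwoShellGap
    (h : ∃ g : ℝ, 0 < g ∧ ∀ (N : ℕ) (x : Fin N → EuclideanSpace ℝ (Fin 3)),
      (∀ i j : Fin N, i ≠ j → 1 / 2 ≤ dist (x i) (x j)) →
      (N : ℝ) * (⨅ Q : PeriodicConfiguration 3, Q.energyPerParticle lennardJones) +
          g * (Nat.card {i : Fin N // ¬ IsTwoShellGood (1 / 20) (47 / 50) 1 x i} : ℝ) ≤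
        interactionEnergy lennardJones x) :
    ∃ g : ℝ, 0 < g ∧ ∀ (N : ℕ) (x : Fin N → EuclideanSpace ℝ (Fin 3)),
      (∀ i j : Fin N, i ≠ j → 1 / 2 ≤ dist (x i) (x j)) →
      (∀ (i : Fin N) (y : EuclideanSpace ℝ (Fin 3)), (∀ j : Fin N, j ≠ i → y ≠ x j) →
        siteEnergy lennardJones x i ≤ ∑ j ∈ Finset.univ.erase i, lennardJones (dist y (x j))) →
      (N : ℝ) * (⨅ Q : PeriodicConfiguration 3, Q.energyPerParticle lennardJones) +
          g * (Nat.card {i : Fin N // ¬ IsTwoShellGood (1 / 20) (47 / 50) 1 x i ∧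
            ∃ p : EuclideanSpace ℝ (Fin 3), dist p (x i) ≤ 6 / 5 ∧ ∀ j : Fin N, 9 / 10 ≤ dist p (x j)} : ℝ) ≤
        interactionEnergy lennardJones x := by
  obtain ⟨g, hg, hG⟩ := h
  exact exposedBadGap_of_nashHalfSepTwoShellGap ⟨g, hg, fun N x hsep _ => hG N x hsep⟩

/-! ## The stub from the crux, from the `1/3`-separated gap, from `CoerciveTwoShellGap`, from the torus gap -/

/-- **The stub is a consequence of the crux**: `NashClassCertificates.NashTwoShellGap`
(stmt-16826) implies the exposed-bad gap on the Nash class (`1/2`-separated ⇒ `1/3`-separated,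
`#{bad ∧ exposed} ≤ #{bad}`). [folklore] -/
theorem exposedBadGap_of_nashTwoShellGap
    (h : Summit.AtomisticToContinuum.Crystallization.Theses.NashClassCertificates.NashTwoShellGap) :
    ∃ g : ℝ, 0 < g ∧ ∀ (N : ℕ) (x : Fin N → EuclideanSpace ℝ (Fin 3)),
      (∀ i j : Fin N, i ≠ j → 1 / 2 ≤ dist (x i) (x j)) →
      (∀ (i : Fin N) (y : EuclideanSpace ℝ (Fin 3)), (∀ j : Fin N, j ≠ i → y ≠ x j) →
        siteEnergy lennardJones x i ≤ ∑ j ∈ Finset.univ.erase i, lennardJones (dist y (x j))) →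
      (N : ℝ) * (⨅ Q : PeriodicConfiguration 3, Q.energyPerParticle lennardJones) +
          g * (Nat.card {i : Fin N // ¬ IsTwoShellGood (1 / 20) (47 / 50) 1 x i ∧
            ∃ p : EuclideanSpace ℝ (Fin 3), dist p (x i) ≤ 6 / 5 ∧ ∀ j : Fin N, 9 / 10 ≤ dist p (x j)} : ℝ) ≤
        interactionEnergy lennardJones x := by
  obtain ⟨g, hg, hG⟩ := h
  refine exposedBadGap_of_nashHalfSepTwoShellGap ⟨g, hg, fun N x hsep hnash => hG N x ?_ hnash⟩
  intro i j hij
  linarith [hsep i j hij]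

/-- **Exposed-bad gap on the Nash class ⇐ the finite two-shell gap at separation `1/3`** (the
`δ`-free form of `CoerciveTwoShellGap`, cf. `coerciveTwoShellGap_iff_sepTwoShellGap`). [folklore] -/
theorem exposedBadGap_of_sepTwoShellGap
    (h : ∃ g : ℝ, 0 < g ∧ ∀ (N : ℕ) (x : Fin N → EuclideanSpace ℝ (Fin 3)),
      (∀ i j : Fin N, i ≠ j → (1 / 3 : ℝ) ≤ dist (x i) (x j)) →
      (N : ℝ) * (⨅ Q : PeriodicConfiguration 3, Q.energyPerParticle lennardJones)
        + g * (Nat.card {i : Fin N // ¬ IsTwoShellGood (1 / 20) (47 / 50) 1 x i} : ℝ)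
        ≤ interactionEnergy lennardJones x) :
    ∃ g : ℝ, 0 < g ∧ ∀ (N : ℕ) (x : Fin N → EuclideanSpace ℝ (Fin 3)),
      (∀ i j : Fin N, i ≠ j → 1 / 2 ≤ dist (x i) (x j)) →
      (∀ (i : Fin N) (y : EuclideanSpace ℝ (Fin 3)), (∀ j : Fin N, j ≠ i → y ≠ x j) →
        siteEnergy lennardJones x i ≤ ∑ j ∈ Finset.univ.erase i, lennardJones (dist y (x j))) →
      (N : ℝ) * (⨅ Q : PeriodicConfiguration 3, Q.energyPerParticle lennardJones) +
          g * (Nat.card {i : Fin N // ¬ IsTwoShellGood (1 / 20) (47 / 50) 1 x i ∧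
            ∃ p : EuclideanSpace ℝ (Fin 3), dist p (x i) ≤ 6 / 5 ∧ ∀ j : Fin N, 9 / 10 ≤ dist p (x j)} : ℝ) ≤
        interactionEnergy lennardJones x := by
  obtain ⟨g, hg, hG⟩ := h
  refine exposedBadGap_of_halfSepTwoShellGap ⟨g, hg, fun N x hsep => hG N x ?_⟩
  intro i j hij
  linarith [hsep i j hij]

/-- **Exposed-bad gap on the Nash class ⇐ `CoerciveTwoShellGap`** (stmt-13956; instantiate
`δ := 1/2`, drop the Nash hypothesis, shrink the charged set). [folklore] -/
theorem exposedBadGap_of_coerciveTwoShellGap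
    (h : Summit.AtomisticToContinuum.Crystallization.Theses.PhononSlackCertificates.CoerciveTwoShellGap) :
    ∃ g : ℝ, 0 < g ∧ ∀ (N : ℕ) (x : Fin N → EuclideanSpace ℝ (Fin 3)),
      (∀ i j : Fin N, i ≠ j → 1 / 2 ≤ dist (x i) (x j)) →
      (∀ (i : Fin N) (y : EuclideanSpace ℝ (Fin 3)), (∀ j : Fin N, j ≠ i → y ≠ x j) →
        siteEnergy lennardJones x i ≤ ∑ j ∈ Finset.univ.erase i, lennardJones (dist y (x j))) →
      (N : ℝ) * (⨅ Q : PeriodicConfiguration 3, Q.energyPerParticle lennardJones) +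
          g * (Nat.card {i : Fin N // ¬ IsTwoShellGood (1 / 20) (47 / 50) 1 x i ∧
            ∃ p : EuclideanSpace ℝ (Fin 3), dist p (x i) ≤ 6 / 5 ∧ ∀ j : Fin N, 9 / 10 ≤ dist p (x j)} : ℝ) ≤
        interactionEnergy lennardJones x :=
  exposedBadGap_of_halfSepTwoShellGap (h (1 / 2) (by norm_num))

/-- **Exposed-bad gap on the Nash class ⇐ the two-shell gap on the torus**
(`∃ g > 0, ∀ P` periodic with `1/3`-separated point set,
`e* + g·#{bad motif points}/#motif ≤ e(P)`), through the tree equivalence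
`CoerciveTwoShellGapBlocks.coerciveTwoShellGap_iff_torusTwoShellGap` (whose classical
`Finset.filter` spelling of the bad motif count is reproduced verbatim). [folklore] -/
theorem exposedBadGap_of_torusTwoShellGap
    (h : ∃ g : ℝ, 0 < g ∧ ∀ P : PeriodicConfiguration 3,
      (∀ u ∈ P.points, ∀ v ∈ P.points, u ≠ v → (1 / 3 : ℝ) ≤ dist u v) →
      (⨅ Q : PeriodicConfiguration 3, Q.energyPerParticle lennardJones)
        + g * ((P.motif.filter fun y => ¬ IsTwoShellGoodSet (1 / 20) (47 / 50) 1 P.points y).card : ℝ)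
            / (P.motif.card : ℝ)
        ≤ P.energyPerParticle lennardJones) :
    ∃ g : ℝ, 0 < g ∧ ∀ (N : ℕ) (x : Fin N → EuclideanSpace ℝ (Fin 3)),
      (∀ i j : Fin N, i ≠ j → 1 / 2 ≤ dist (x i) (x j)) →
      (∀ (i : Fin N) (y : EuclideanSpace ℝ (Fin 3)), (∀ j : Fin N, j ≠ i → y ≠ x j) →
        siteEnergy lennardJones x i ≤ ∑ j ∈ Finset.univ.erase i, lennardJones (dist y (x j))) →
      (N : ℝ) * (⨅ Q : PeriodicConfiguration 3, Q.energyPerParticle lennardJones) +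
          g * (Nat.card {i : Fin N // ¬ IsTwoShellGood (1 / 20) (47 / 50) 1 x i ∧
            ∃ p : EuclideanSpace ℝ (Fin 3), dist p (x i) ≤ 6 / 5 ∧ ∀ j : Fin N, 9 / 10 ≤ dist p (x j)} : ℝ) ≤
        interactionEnergy lennardJones x :=
  exposedBadGap_of_coerciveTwoShellGap
    (Summit.AtomisticToContinuum.Crystallization.Theorems.CoerciveTwoShellGapBlocks.coerciveTwoShellGap_iff_torusTwoShellGap.2
      h)

/-! ## Registered sub-goal (bookkeeping; not part of the composition `NashTwoShellGap_of`) -/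

/-- **Registered sub-goal `stub_exposedOfTorusGap`** (worker of line `birth`; bookkeeping, not
part of the composition `NashTwoShellGap_of`): the two-shell gap on the torus at tolerance `1/20`
implies the line's exposed-bad gap on the Nash class, i.e. the registered stub
`stub_exposedBadGap` (verbatim) — `exposedBadGap_of_torusTwoShellGap`.  So the exposed stub, like
the jammed one (`NashTwoShellGapReductions.stub_jammedOfTorusGap`), is a consequence of the shared
residual core of crux 13956. [folklore] -/
theorem stub_exposedOfTorusGap : (∃ g : ℝ, 0 < g ∧ ∀ P : Literature.MathematicalPhysics.StatisticalMechanics.PeriodicConfiguration 3, (∀ u ∈ P.points, ∀ v ∈ P.points, u ≠ v → (1 / 3 : ℝ) ≤ dist u v) → (⨅ Q : Literature.MathematicalPhysics.StatisticalMechanics.PeriodicConfiguration 3, Q.energyPerParticle Literature.MathematicalPhysics.StatisticalMechanics.lennardJones) + g * ((P.motif.filter fun y => ¬ Literature.Geometry.DiscreteGeometry.IsTwoShellGoodSet (1 / 20) (47 / 50) 1 P.points y).card : ℝ) / (P.motif.card : ℝ) ≤ P.energyPerParticle Literature.MathematicalPhysics.StatisticalMechanics.lennardJones) → ∃ g : ℝ,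 0 < g ∧ ∀ (N : ℕ) (x : Fin N → EuclideanSpace ℝ (Fin 3)), (∀ i j : Fin N, i ≠ j → 1 / 2 ≤ dist (x i) (x j)) → (∀ (i : Fin N) (y : EuclideanSpace ℝ (Fin 3)), (∀ j : Fin N, j ≠ i → y ≠ x j) → Literature.MathematicalPhysics.StatisticalMechanics.siteEnergy Literature.MathematicalPhysics.StatisticalMechanics.lennardJones x i ≤ ∑ j ∈ Finset.univ.erase i, Literature.MathematicalPhysics.StatisticalMechanics.lennardJones (dist y (x j))) → (N : ℝ) * (⨅ Q : Literature.MathematicalPhysics.StatisticalMechanics.PeriodicConfiguration 3, Q.energyPerParticle Literature.MathematicalPhysics.StatisticalMechanics.lennardJones) + g * (Nat.card {i : Fin N // ¬ Literature.Geometry.DiscreteGeometry.IsTwoShellGood (1 / 20) (47 / 50) 1 x i ∧ ∃ p : EuclideanSpace ℝ (Fin 3), dist p (x i) ≤ 6 / 5 ∧ ∀ j : Fin N, 9 / 10 ≤ dist p (x j)} : ℝ) ≤ Literature.MathematicalPhysics.StatisticalMechanics.interactionEnergy Literature.MathematicalPhysics.StatisticalMechanics.lennardJones x :=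
  exposedBadGap_of_torusTwoShellGap

end Summit.AtomisticToContinuum.Crystallization.Theorems.NashTwoShellGapExposedBadGap

end
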